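import Summits.QuantumFields.BalabanUV.Beta.GAN24.DerivativeRateTransferJensen

/-!
# `BalabanUV.Beta.GAN24.DerivativeRateTransferJensenMeanZero` — binder row G-an2-4 ∕ (CONV-C), route R6 «VALUES, NOT DERIVATIVES», PART 47:
# THE CONSISTENT-PAIR COVARIANT JENSEN INEQUALITY — (STAB-ε,δ) whose additive slack is carried by the MEAN root-frame holonomy defect `κ₂`
# of a block (second order for Bałaban's AVERAGED coarse link, first order for straight block-products), not by the pointwise defect `κ`:
# `Qᵀ H_c Q ≤ (1 + t + (1+t⁻¹)(1+r)·ϖ·κ²)·H_f + (1+t⁻¹)(1+r⁻¹)·κ₂²·w_c·d′·QᵀQ` for all `t, r > 0` (unit b2b-balaban-gan24-p3, gen 42; v1)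

NOT IN PRINT; OUR PROOF (for the ROUTE; [folklore] finite-dimensional linear algebra over `ℝ` — PART 21's one-chain letters and PART 22's block letters
BY NAME + `Matrix.sum_mulVec`, `Finset.sum_fiberwise'`, `Equiv.sum_comp`).  HONEST FRAMING (cell contract, verbatim): «discharging `BetaPertH` makes
Bałaban's UV stability UNCONDITIONAL — a real constructive-QFT result; it is NOT the continuum limit and NOT the Clay problem.»  HONEST DEPENDENCY
(verbatim): «continuum YM on T⁴ ⇐ BetaPertH ∧ nine spine estimates (0/9 proved); BetaPertH ⇐ (D1) ∧ (D4) ∧ CAP+tail; G-an2-4 gates asym, D1 and NE2/3/4.»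

WHY THIS FILE.  PART 22 (`DerivativeRateTransferJensen.covJensen_holonomy`) proves (STAB-ε,δ) `QᵀH_cQ ≤ (1+t)H_f + (1+t⁻¹)κ²w_c g·1` with `κ` the
POINTWISE loop-holonomy defect `|(V(e′,x) − 1)w| ≤ κ|w|` of the loops «block contour → coarse bond → block contour back → fine chain back»: the additive
(mass-like) slack is `κ²`, SECOND order in the curvature, whatever the coarse transporters `R′` are.  The covariant toy of gen 41 (RESULT R-gan24p3-g41-1,
`HOME/b2b-balaban-gan24-p3/gen41/R6-PROPAGATOR-DEFECT-NOTE.md` §3b; replicated by gan24-idea-1 g53, ROUTES-GAN24 v53 lens item 10) located that the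
one-step stability is decided by the PAIR (averaging root, coarse connection): with Bałaban's averaged coarse link `Ū` ([CMP 95 (1.8)], [CMP 98 (42)])
— DEFINED as the exponential of the block MEAN of the logarithms of exactly these loop transports — the root-frame loop angles `α_x` have block mean
ZERO, so the block mean of the defects `Σ_x q(y,x)(1 − V̂_x)` is `O(α²)`, while for straight block-products it is `O(α)` (the strip flux).  THIS FILE is
the kernel form of that dichotomy: the coarse covariant difference of a transported block mean splits EXACTLY (§2 `coarseDiff_avg_eq_three`) as
  `D′_{e′}(Qu) = Σ_x q·W(y,x)(T_x u(σx) − u(x))` (block mean of transported CHAINS of fine differences — PART 22's term)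
  `+ Σ_x q·N_x·(z_x − c)` (pointwise defects `N_x := 1 − W(y,x)T_xW(y′,σx)ᵀR′ᵀ` acting on the FLUCTUATION of the transported field `z_x := R′W(y′,σx)u(σx)`
  around `c := R′(Qu)(y′)`) `+ (Σ_x q·N_x)·c` (the MEAN defect acting on the block mean),
so that, with `|N_x w| ≤ κ|w|` (PART 22's `κ`, read in the root frame — §2 `rootDefect_le`), `|(Σ_x q(y,x)N_x) w| ≤ κ₂|w|` (THE NEW LETTER) and a block
POINCARÉ datum `Σ_x q(y,x)|W(y,x)u(x) − (Qu)(y)|² ≤ Φ(y)` with `w_c·Σ_{e′}Φ(tgt′e′) ≤ ϖ·⟨u,H_f u⟩` (for the lattice: the taxi-tree Poincaré inequality of a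
block, `ϖ = O(d·L²)` — NOT proved here, a hypothesis), three Peter–Paul splits, Jensen in the block and the counting sums of PART 22 give (§3)
  `⟨Qu,H_cQu⟩ ≤ (1 + t + (1+t⁻¹)(1+r)ϖκ²)·⟨u,H_f u⟩ + (1+t⁻¹)(1+r⁻¹)κ₂²·w_c·d′·⟨Qu,Qu⟩`   (`d′` = in-degree of the coarse bond graph),
i.e. (STAB-ε,δ) of PART 20 with `G = QᵀQ` (a mass on the COARSE field), `ε = t + (1+t⁻¹)(1+r)ϖκ²`, `δ = (1+t⁻¹)(1+r⁻¹)κ₂²w_c d′`.  For a CONSISTENT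
pair (`κ₂ ≤ c·κ²`; `t = κ`, `r = 1`): `ε = (1 + 2ϖ(1+κ))·κ`, `δ = 2c²(1+κ)·κ³·w_c d′` — additive slack of THIRD order at relative slack `O(κ)`, against
PART 22's `δ = (1+κ⁻¹)κ²·w_c g = O(κ)` at the same `ε` (PART 48 `DerivativeRateTransferJensenMeanZeroEnd.covJensen_consistent`); for an INCONSISTENT pair
(`κ₂ ≍ κ`) nothing is gained — the located dichotomy of the toy, as a theorem about letters.

WHAT THIS FILE PROVES (0 sorry, 0 `def`, nothing cited):
* §1 tools: `dotProduct_self_add_add_le` (three-term Peter–Paul), `dotProduct_self_wsum_defect_le` (Jensen against pointwise defects),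
  `sum_tgt_le_of_indegree` (`Σ_{e′}F(tgt′e′) ≤ d′·Σ_y F(y)`).
* §2 identities: `rootDefect_eq` (`R′W′a − W T a = (1 − W T W′ᵀR′ᵀ)(R′W′a)`), `rootDefect_le` (PART 22's `|(V − 1)w| ≤ κ|w|`, `V = WᵀR′W′Tᵀ`, read in the
  root frame), **`coarseDiff_avg_eq_three`** (the exact three-term split, any `c`).
* §3 `sum_tgt_blockMean_le`, **`covJensen_meanZero`** (the inequality above, every `t, r > 0`) and **`posSemidef_covJensen_meanZero`**
  (`((1 + t + (1+t⁻¹)(1+r)ϖκ²)•H_f + ((1+t⁻¹)(1+r⁻¹)κ₂²w_c d′)•QᵀQ − QᵀH_cQ).PosSemidef` — (STAB-ε,δ) as PART 20 consumes it, `G = QᵀQ`).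
The corollaries (the consistent pair `κ₂ ≤ c·κ²`; the END fed by PART 22's loop letter `V` verbatim; the abelian dictionary «mean loop angle zero ⟹
`κ₂ ≤ κ²`») are PART 48 `DerivativeRateTransferJensenMeanZeroEnd`; the Poincaré datum `hP ∕ hΦ` is DISCHARGED for block transporters that are products
of the fine transporters along a rooted tree of fine bonds (Bałaban's contours as letters) in PART 49 `DerivativeRateTransferJensenMeanZeroTree`.
WHAT IT DOES NOT DO: instantiate the letters on PART 24's lattice encoding (taxi trees; a later PART, on request), assert that Bałaban's `Q(U)` ∕
`Δ^{(k)}(U)` ∕ `Ū` instantiate the letters (S2(ii)), or say anything about (CONS) ∕ exact (STAB) (the toy's `λ_min D_j > 0` for consistent pairs is NOT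
claimed).  SUPPLIER
work on route R6 (rank 2, REDUCTION, no seat); no consumer of record; NEVER «G-an2-4 closed»; NOT (CONV-C), NOT D1, NOT `BetaPertH`, NOT continuum, NOT
Clay.  Records: `HOME/b2b-balaban-gan24-p3/WOODBURY-FIBRE.md` v14.2, `HOME/b2b-balaban-gan24-refuter/PRICING-GAN24.md` v3.46 (C-R6° cell: «(STAB)^{cov}
NEEDS-ROW + NEEDS-CONSTANT, constants WITH the averaging convention»). -/

noncomputable section

open Matrix Finset

namespace Summit.QuantumFields.BalabanUV.Beta.GAN24.DerivativeRateTransferJensenMeanZero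

open Summit.QuantumFields.BalabanUV.Beta.GAN24.DerivativeRateTransferLoewnerKKT (mulVec_dotProduct_eq)
open Summit.QuantumFields.BalabanUV.Beta.GAN24.DerivativeRateTransferJensenChain
open Summit.QuantumFields.BalabanUV.Beta.GAN24.DerivativeRateTransferJensen

/-! ## §1 Tools: three-term Peter–Paul, Jensen against pointwise defects, the in-degree count -/

section Tools

variable {o : Type*} [Fintype o]

/-- **THREE-TERM PETER–PAUL**: `|a + b + c|² ≤ (1+t)|a|² + (1+t⁻¹)((1+r)|b|² + (1+r⁻¹)|c|²)` for `t, r > 0`. [folklore] -/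
theorem dotProduct_self_add_add_le (a b c : o → ℝ) {t r : ℝ} (ht : 0 < t) (hr : 0 < r) :
    (a + b + c) ⬝ᵥ (a + b + c) ≤ (1 + t) * (a ⬝ᵥ a) + (1 + t⁻¹) * ((1 + r) * (b ⬝ᵥ b) + (1 + r⁻¹) * (c ⬝ᵥ c)) := by
  have h1 := dotProduct_self_add_le a (b + c) ht
  have h2 := dotProduct_self_add_le b c hr
  have ht' : (0 : ℝ) ≤ 1 + t⁻¹ := by positivity
  rw [add_assoc]
  exact h1.trans (add_le_add le_rfl (mul_le_mul_of_nonneg_left h2 ht'))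

/-- **JENSEN AGAINST POINTWISE DEFECTS**: weights `q ≥ 0`, `Σ q ≤ 1`, maps `N_x` with `|N_x w|² ≤ κ²|w|²` ⟹ `|Σ_x q_x·N_x v_x|² ≤ κ²·Σ_x q_x|v_x|²`. [folklore] -/
theorem dotProduct_self_wsum_defect_le {ν : Type*} (s : Finset ν) {q : ν → ℝ} (hq : ∀ x ∈ s, 0 ≤ q x) (hq1 : ∑ x ∈ s, q x ≤ 1)
    {N : ν → Matrix o o ℝ} {κ : ℝ} (hN : ∀ x ∈ s, ∀ w : o → ℝ, (N x *ᵥ w) ⬝ᵥ (N x *ᵥ w) ≤ κ ^ 2 * (w ⬝ᵥ w)) (v : ν → o → ℝ) :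
    (∑ x ∈ s, q x • (N x *ᵥ v x)) ⬝ᵥ (∑ x ∈ s, q x • (N x *ᵥ v x)) ≤ κ ^ 2 * ∑ x ∈ s, q x * (v x ⬝ᵥ v x) := by
  refine (dotProduct_self_wsum_le' s hq hq1 _).trans ?_
  rw [Finset.mul_sum]
  refine Finset.sum_le_sum fun x hx => ?_
  calc q x * ((N x *ᵥ v x) ⬝ᵥ (N x *ᵥ v x)) ≤ q x * (κ ^ 2 * (v x ⬝ᵥ v x)) := mul_le_mul_of_nonneg_left (hN x hx (v x)) (hq x hx)
    _ = κ ^ 2 * (q x * (v x ⬝ᵥ v x)) := by ring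

/-- **THE IN-DEGREE COUNT**: if every coarse site is the target of at most `d′` coarse bonds, `Σ_{e′} F(tgt′e′) ≤ d′·Σ_y F(y)` for `F ≥ 0`. [folklore] -/
theorem sum_tgt_le_of_indegree {β' μ : Type*} [Fintype β'] [Fintype μ] [DecidableEq μ] (tgt' : β' → μ) {d' : ℝ}
    (hdeg : ∀ y, ((Finset.univ.filter fun e' => tgt' e' = y).card : ℝ) ≤ d') (F : μ → ℝ) (hF : ∀ y, 0 ≤ F y) :
    ∑ e', F (tgt' e') ≤ d' * ∑ y, F y := by
  rw [← Finset.sum_fiberwise' Finset.univ tgt' F, Finset.mul_sum]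
  refine Finset.sum_le_sum fun y _ => ?_
  rw [Finset.sum_const, nsmul_eq_mul]
  exact mul_le_mul_of_nonneg_right (hdeg y) (hF y)

end Tools

/-! ## §2 Identities: the root-frame defect and the exact three-term split of the coarse covariant difference -/

section Identity

variable {o μ ν : Type*} [Fintype o] [DecidableEq o] [Fintype μ] [Fintype ν]

omit [Fintype μ] [Fintype ν] in
/-- **`rootDefect_eq`**: `R′W′a − W(T a) = (1 − W·T·W′ᵀ·R′ᵀ)·(R′W′a)` for `W′`, `R′` orthogonal — the holonomy defect of a transported pair, written as a
map of the ROOT frame applied to the transported field. [folklore] -/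
theorem rootDefect_eq {W W' R' Tl : Matrix o o ℝ} (hW' : W'ᵀ * W' = 1) (hR' : R'ᵀ * R' = 1) (a : o → ℝ) :
    R' *ᵥ (W' *ᵥ a) - W *ᵥ (Tl *ᵥ a) = (1 - W * Tl * W'ᵀ * R'ᵀ) *ᵥ (R' *ᵥ (W' *ᵥ a)) := by
  have key : W * Tl * W'ᵀ * R'ᵀ * (R' * W') = W * Tl := by
    calc W * Tl * W'ᵀ * R'ᵀ * (R' * W') = W * Tl * (W'ᵀ * ((R'ᵀ * R') * W')) := by simp only [Matrix.mul_assoc]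
      _ = W * Tl := by rw [hR', Matrix.one_mul, hW', Matrix.mul_one]
  simp only [mulVec_mulVec]
  rw [Matrix.sub_mul, Matrix.one_mul, key, sub_mulVec]

omit [Fintype μ] [Fintype ν] in
/-- **`rootDefect_le`** — PART 22's loop letter read in the root frame: with `W, W′, R′, T` orthogonal and `|(V − 1)w|² ≤ κ²|w|²` for `V = WᵀR′W′Tᵀ`,
also `|(1 − W·T·W′ᵀ·R′ᵀ) w|² ≤ κ²|w|²` (`1 − WTW′ᵀR′ᵀ = (WTW′ᵀR′ᵀW)·(V − 1)·Wᵀ`, orthogonal factors). [folklore] -/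
theorem rootDefect_le {W W' R' Tl : Matrix o o ℝ} (hW : Wᵀ * W = 1) (hW' : W'ᵀ * W' = 1) (hR' : R'ᵀ * R' = 1) (hT : Tlᵀ * Tl = 1)
    {κ : ℝ} (hV : ∀ w : o → ℝ, ((Wᵀ * R' * W' * Tlᵀ - 1) *ᵥ w) ⬝ᵥ ((Wᵀ * R' * W' * Tlᵀ - 1) *ᵥ w) ≤ κ ^ 2 * (w ⬝ᵥ w))
    (w : o → ℝ) :
    ((1 - W * Tl * W'ᵀ * R'ᵀ) *ᵥ w) ⬝ᵥ ((1 - W * Tl * W'ᵀ * R'ᵀ) *ᵥ w) ≤ κ ^ 2 * (w ⬝ᵥ w) := by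
  have hWWt : W * Wᵀ = 1 := mul_transpose_of_orthogonal hW
  have hTTt : Tl * Tlᵀ = 1 := mul_transpose_of_orthogonal hT
  -- the orthogonal prefactor `Y := W T W′ᵀ R′ᵀ W`
  have hY : (W * Tl * W'ᵀ * R'ᵀ * W)ᵀ * (W * Tl * W'ᵀ * R'ᵀ * W) = 1 :=
    orthogonal_mul (orthogonal_mul (orthogonal_mul (orthogonal_mul hW hT) (transpose_orthogonal hW')) (transpose_orthogonal hR')) hW
  have key : W * Tl * W'ᵀ * R'ᵀ * W * (Wᵀ * R' * W' * Tlᵀ - 1) * Wᵀ = 1 - W * Tl * W'ᵀ * R'ᵀ := by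
    rw [mul_sub, Matrix.mul_one, sub_mul]
    congr 1
    · calc W * Tl * W'ᵀ * R'ᵀ * W * (Wᵀ * R' * W' * Tlᵀ) * Wᵀ
          = W * (Tl * (W'ᵀ * (R'ᵀ * (W * Wᵀ) * R') * W') * Tlᵀ) * Wᵀ := by simp only [Matrix.mul_assoc]
        _ = 1 := by rw [hWWt, Matrix.mul_one, hR', Matrix.mul_one, hW', Matrix.mul_one, hTTt, Matrix.mul_one, hWWt]
    · calc W * Tl * W'ᵀ * R'ᵀ * W * Wᵀ = W * Tl * W'ᵀ * R'ᵀ * (W * Wᵀ) := by simp only [Matrix.mul_assoc]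
        _ = W * Tl * W'ᵀ * R'ᵀ := by rw [hWWt, Matrix.mul_one]
  have e : (1 - W * Tl * W'ᵀ * R'ᵀ) *ᵥ w = (W * Tl * W'ᵀ * R'ᵀ * W) *ᵥ ((Wᵀ * R' * W' * Tlᵀ - 1) *ᵥ (Wᵀ *ᵥ w)) := by
    rw [mulVec_mulVec, mulVec_mulVec, key]
  rw [e, self_of_orthogonal hY]
  refine (hV _).trans (le_of_eq ?_)
  rw [self_of_orthogonal (transpose_orthogonal hW)]

omit [Fintype μ] in
/-- **`coarseDiff_avg_eq_three` — THE EXACT THREE-TERM SPLIT** [our proof].  With `(Qu)(y) = Σ_x q(y,x)W(y,x)u(x)`, a weight-carrying pairing `σ`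
(`q(y′,σx) = q(y,x)`), orthogonal `W(y′,·)`, `R′`, any chain transports `T_x` and ANY vector `c` (below: `c = R′(Qu)(y′)`):
`R′(Qu)(y′) − (Qu)(y) = Σ_x q(y,x)·W(y,x)(T_x u(σx) − u(x)) + Σ_x q(y,x)·N_x(R′W(y′,σx)u(σx) − c) + (Σ_x q(y,x)·N_x)·c`,
`N_x := 1 − W(y,x)·T_x·W(y′,σx)ᵀ·R′ᵀ`. -/
theorem coarseDiff_avg_eq_three {q : μ → ν → ℝ} {W : μ → ν → Matrix o o ℝ} {Q : Matrix (μ × o) (ν × o) ℝ}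
    (hQ : ∀ (u : ν × o → ℝ) (y : μ), (fun a => (Q *ᵥ u) (y, a)) = ∑ x, q y x • (W y x *ᵥ fun b => u (x, b)))
    {y y' : μ} {R' : Matrix o o ℝ} (hR' : R'ᵀ * R' = 1) (hW' : ∀ x, (W y' x)ᵀ * W y' x = 1) (σ : ν ≃ ν)
    (hσq : ∀ x, q y' (σ x) = q y x) (Tl : ν → Matrix o o ℝ) {N : ν → Matrix o o ℝ}
    (hN : ∀ x, N x = 1 - W y x * Tl x * (W y' (σ x))ᵀ * R'ᵀ) (c : o → ℝ) (u : ν × o → ℝ) :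
    (R' *ᵥ fun a => (Q *ᵥ u) (y', a)) - (fun a => (Q *ᵥ u) (y, a)) =
      ∑ x, q y x • (W y x *ᵥ (Tl x *ᵥ (fun b => u (σ x, b)) - fun b => u (x, b)))
      + ∑ x, q y x • (N x *ᵥ ((R' *ᵥ (W y' (σ x) *ᵥ fun b => u (σ x, b))) - c))
      + (∑ x, q y x • N x) *ᵥ c := by
  rw [coarseDiff_avg_eq hQ R' σ hσq u]
  have hx : ∀ x, (R' *ᵥ (W y' (σ x) *ᵥ fun b => u (σ x, b))) - W y x *ᵥ (fun b => u (x, b)) =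
      W y x *ᵥ (Tl x *ᵥ (fun b => u (σ x, b)) - fun b => u (x, b))
      + (N x *ᵥ ((R' *ᵥ (W y' (σ x) *ᵥ fun b => u (σ x, b))) - c) + N x *ᵥ c) := fun x => by
    rw [← mulVec_add, sub_add_cancel, hN x, ← rootDefect_eq (hW' (σ x)) hR', mulVec_sub]
    abel
  simp_rw [hx, smul_add, Finset.sum_add_distrib]
  rw [add_assoc]
  congr 2
  rw [Matrix.sum_mulVec]
  exact Finset.sum_congr rfl fun x _ => (smul_mulVec _ _ _).symm

end Identity

/-! ## §3 THE END: the consistent-pair covariant Jensen inequality -/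

section End

variable {o μ ν β β' : Type*} [Fintype o] [DecidableEq o] [Fintype μ] [DecidableEq μ] [Fintype ν] [Fintype β] [DecidableEq β] [Fintype β']
variable {q : μ → ν → ℝ} {W : μ → ν → Matrix o o ℝ} {Q : Matrix (μ × o) (ν × o) ℝ}
variable {src tgt : β → ν} {R : β → Matrix o o ℝ} {src' tgt' : β' → μ} {R' : β' → Matrix o o ℝ}
variable {Hf : Matrix (ν × o) (ν × o) ℝ} {Hc : Matrix (μ × o) (μ × o) ℝ} {wf wc : ℝ}
variable {σ : β' → ν ≃ ν} {ℓ : ℕ} {xs : β' → ν → ℕ → ν} {γ : β' → ν → ℕ → β} {T : β' → ν → ℕ → Matrix o o ℝ} {m : ℝ}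
variable {N : β' → ν → Matrix o o ℝ} {Φ : (ν × o → ℝ) → μ → ℝ} {ϖ d' κ κ₂ : ℝ}

omit [DecidableEq o] [DecidableEq β] in
/-- `Σ_y |(Qu)(y)|²`-bookkeeping: `Σ_{e′} |(Qu)(tgt′e′)|² ≤ d′·⟨Qu, Qu⟩` under the in-degree count. [folklore] -/
theorem sum_tgt_blockMean_le (hdeg : ∀ y, ((Finset.univ.filter fun e' => tgt' e' = y).card : ℝ) ≤ d') (v : μ × o → ℝ) :
    ∑ e', ((fun a => v (tgt' e', a)) ⬝ᵥ fun a => v (tgt' e', a)) ≤ d' * (v ⬝ᵥ v) := by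
  rw [dotProduct_self_eq_sum_sites v]
  exact sum_tgt_le_of_indegree tgt' hdeg (fun y => (fun a => v (y, a)) ⬝ᵥ fun a => v (y, a)) fun y => dotProduct_self_nonneg' _

/-- **`covJensen_meanZero` — THE CONSISTENT-PAIR COVARIANT JENSEN INEQUALITY** [our proof].  Structure as in PART 22's `covJensen_holonomy` (block
weights `q ≥ 0`, `Σ_x q(y,x) ≤ 1`, orthogonal block transporters `W`, fine bond transporters `R`, coarse bond transporters `R′` — here ALSO orthogonal —,
the averaging identity `hQ`, the form bounds `hHc` ∕ `hHf`, weight-carrying pairings `σ`, straight chains `xs ∕ γ ∕ T` of length `ℓ`, q-weighted chain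
multiplicity `≤ m`, bookkeeping `w_c·ℓ·m ≤ w_f`), plus: the root-frame defects `N(e′,x) = 1 − W(src′e′,x)·T(e′,x,ℓ)·W(tgt′e′,σx)ᵀ·R′_{e′}ᵀ` with the
POINTWISE bound `|N w|² ≤ κ²|w|²`, the MEAN bound `|(Σ_x q(src′e′,x)·N(e′,x)) w|² ≤ κ₂²|w|²`, a block Poincaré datum
`Σ_x q(y,x)|W(y,x)u(x) − (Qu)(y)|² ≤ Φ(y)` with `w_c·Σ_{e′}Φ(tgt′e′) ≤ ϖ·⟨u,H_f u⟩`, and in-degree `≤ d′` of the coarse bond graph.  THEN for all `t, r > 0`: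
`⟨Qu, H_cQu⟩ ≤ (1 + t + (1+t⁻¹)(1+r)ϖκ²)·⟨u, H_f u⟩ + (1+t⁻¹)(1+r⁻¹)κ₂²·w_c·d′·⟨Qu, Qu⟩`. -/
theorem covJensen_meanZero
    (hq : ∀ y x, 0 ≤ q y x) (hq1 : ∀ y, ∑ x, q y x ≤ 1) (hW : ∀ y x, (W y x)ᵀ * W y x = 1) (hR : ∀ e, (R e)ᵀ * R e = 1)
    (hR' : ∀ e', (R' e')ᵀ * R' e' = 1)
    (hQ : ∀ (u : ν × o → ℝ) (y : μ), (fun a => (Q *ᵥ u) (y, a)) = ∑ x, q y x • (W y x *ᵥ fun b => u (x, b)))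
    (hwc : 0 ≤ wc)
    (hHc : ∀ v : μ × o → ℝ, v ⬝ᵥ (Hc *ᵥ v) ≤
      wc * ∑ e', ((R' e' *ᵥ fun a => v (tgt' e', a)) - fun a => v (src' e', a)) ⬝ᵥ
        ((R' e' *ᵥ fun a => v (tgt' e', a)) - fun a => v (src' e', a)))
    (hHf : ∀ u : ν × o → ℝ, wf * ∑ e, ((R e *ᵥ fun b => u (tgt e, b)) - fun b => u (src e, b)) ⬝ᵥ
        ((R e *ᵥ fun b => u (tgt e, b)) - fun b => u (src e, b)) ≤ u ⬝ᵥ (Hf *ᵥ u))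
    (hσq : ∀ e' x, q (tgt' e') (σ e' x) = q (src' e') x)
    (hx0 : ∀ e' x, xs e' x 0 = x) (hxℓ : ∀ e' x, xs e' x ℓ = σ e' x)
    (hsrc : ∀ e' x i, i < ℓ → src (γ e' x i) = xs e' x i) (htgt : ∀ e' x i, i < ℓ → tgt (γ e' x i) = xs e' x (i + 1))
    (hT0 : ∀ e' x, T e' x 0 = 1) (hT : ∀ e' x i, i < ℓ → T e' x (i + 1) = T e' x i * R (γ e' x i))
    (hmult : ∀ e, ∑ e', ∑ x, ∑ i ∈ range ℓ, (if γ e' x i = e then q (src' e') x else 0) ≤ m)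
    (hw : wc * ℓ * m ≤ wf)
    (hNdef : ∀ e' x, N e' x = 1 - W (src' e') x * T e' x ℓ * (W (tgt' e') (σ e' x))ᵀ * (R' e')ᵀ)
    (hN : ∀ e' x (w : o → ℝ), (N e' x *ᵥ w) ⬝ᵥ (N e' x *ᵥ w) ≤ κ ^ 2 * (w ⬝ᵥ w))
    (hM : ∀ e' (w : o → ℝ), ((∑ x, q (src' e') x • N e' x) *ᵥ w) ⬝ᵥ ((∑ x, q (src' e') x • N e' x) *ᵥ w) ≤ κ₂ ^ 2 * (w ⬝ᵥ w))
    (u : ν × o → ℝ)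
    (hP : ∀ y, ∑ x, q y x * (((W y x *ᵥ fun b => u (x, b)) - fun a => (Q *ᵥ u) (y, a)) ⬝ᵥ
        ((W y x *ᵥ fun b => u (x, b)) - fun a => (Q *ᵥ u) (y, a))) ≤ Φ u y)
    (hΦ : wc * ∑ e', Φ u (tgt' e') ≤ ϖ * (u ⬝ᵥ (Hf *ᵥ u)))
    (hdeg : ∀ y, ((Finset.univ.filter fun e' => tgt' e' = y).card : ℝ) ≤ d')
    {t r : ℝ} (ht : 0 < t) (hr : 0 < r) :
    (Q *ᵥ u) ⬝ᵥ (Hc *ᵥ (Q *ᵥ u)) ≤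
      (1 + t + (1 + t⁻¹) * (1 + r) * ϖ * κ ^ 2) * (u ⬝ᵥ (Hf *ᵥ u)) +
        (1 + t⁻¹) * (1 + r⁻¹) * κ₂ ^ 2 * wc * d' * ((Q *ᵥ u) ⬝ᵥ (Q *ᵥ u)) := by
  -- abbreviations: fine bond energies `F e`, block variances (hP's left side) are bounded by `Φ u y`, block-mean masses `G y`
  set F : β → ℝ := fun e => ((R e *ᵥ fun b => u (tgt e, b)) - fun b => u (src e, b)) ⬝ᵥ
    ((R e *ᵥ fun b => u (tgt e, b)) - fun b => u (src e, b)) with hF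
  set G : μ → ℝ := fun y => (fun a => (Q *ᵥ u) (y, a)) ⬝ᵥ fun a => (Q *ᵥ u) (y, a) with hG
  have hF0 : ∀ e, 0 ≤ F e := fun e => dotProduct_self_nonneg' _
  have ht' : (0 : ℝ) ≤ 1 + t⁻¹ := by positivity
  have hr' : (0 : ℝ) ≤ 1 + r⁻¹ := by positivity
  have hr1 : (0 : ℝ) ≤ 1 + r := by positivity
  -- per coarse bond: the three-term split and its bound
  have hper : ∀ e',
      ((R' e' *ᵥ fun a => (Q *ᵥ u) (tgt' e', a)) - fun a => (Q *ᵥ u) (src' e', a)) ⬝ᵥ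
          ((R' e' *ᵥ fun a => (Q *ᵥ u) (tgt' e', a)) - fun a => (Q *ᵥ u) (src' e', a)) ≤
        (1 + t) * (ℓ * ∑ x, q (src' e') x * ∑ i ∈ range ℓ, F (γ e' x i)) +
          (1 + t⁻¹) * ((1 + r) * (κ ^ 2 * Φ u (tgt' e')) + (1 + r⁻¹) * (κ₂ ^ 2 * G (tgt' e'))) := by
    intro e'
    set c : o → ℝ := R' e' *ᵥ fun a => (Q *ᵥ u) (tgt' e', a) with hc
    rw [coarseDiff_avg_eq_three hQ (hR' e') (fun x => hW (tgt' e') x) (σ e') (hσq e') (fun x => T e' x ℓ) (fun x => hNdef e' x) c u]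
    refine (dotProduct_self_add_add_le _ _ _ ht hr).trans ?_
    refine add_le_add ?_ (mul_le_mul_of_nonneg_left (add_le_add ?_ ?_) ht')
    · -- (A) the chain term: Jensen in the block, the chain bound
      refine mul_le_mul_of_nonneg_left ?_ (by linarith)
      refine (dotProduct_self_wsum_le Finset.univ (fun x _ => hq _ x) (hq1 _) (fun x _ => hW (src' e') x) _).trans ?_
      rw [Finset.mul_sum]
      refine Finset.sum_le_sum fun x _ => ?_
      have hTl := orthogonal_partialTransport (R := fun i => R (γ e' x i)) (fun i _ => hR _) (hT0 e' x) (fun i hi => hT e' x i hi)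
      have h := dotProduct_self_chain_le (R := fun i => R (γ e' x i)) (T := T e' x) (fun i _ => hR _) (hT0 e' x)
        (fun i hi => hT e' x i hi) (fun i => fun b => u (xs e' x i, b))
      rw [hxℓ, hx0] at h
      have hs : ∑ i ∈ range ℓ, F (γ e' x i) =
          ∑ i ∈ range ℓ, ((R (γ e' x i) *ᵥ fun b => u (xs e' x (i + 1), b)) - fun b => u (xs e' x i, b)) ⬝ᵥ
            ((R (γ e' x i) *ᵥ fun b => u (xs e' x (i + 1), b)) - fun b => u (xs e' x i, b)) :=
        Finset.sum_congr rfl fun i hi => by simp only [hF]; rw [hsrc e' x i (mem_range.mp hi), htgt e' x i (mem_range.mp hi)]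
      rw [hs]
      calc q (src' e') x * ((T e' x ℓ *ᵥ (fun b => u (σ e' x, b)) - fun b => u (x, b)) ⬝ᵥ
              (T e' x ℓ *ᵥ (fun b => u (σ e' x, b)) - fun b => u (x, b)))
          ≤ q (src' e') x * (ℓ * ∑ i ∈ range ℓ, ((R (γ e' x i) *ᵥ fun b => u (xs e' x (i + 1), b)) - fun b => u (xs e' x i, b)) ⬝ᵥ
              ((R (γ e' x i) *ᵥ fun b => u (xs e' x (i + 1), b)) - fun b => u (xs e' x i, b))) :=
            mul_le_mul_of_nonneg_left h (hq _ x)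
        _ = ℓ * (q (src' e') x * ∑ i ∈ range ℓ, ((R (γ e' x i) *ᵥ fun b => u (xs e' x (i + 1), b)) - fun b => u (xs e' x i, b)) ⬝ᵥ
              ((R (γ e' x i) *ᵥ fun b => u (xs e' x (i + 1), b)) - fun b => u (xs e' x i, b))) := by ring
    · -- (B) pointwise defects against the fluctuation: Jensen, `κ`, reindexing by `σ`, the Poincaré datum
      refine mul_le_mul_of_nonneg_left ?_ hr1
      refine (dotProduct_self_wsum_defect_le Finset.univ (fun x _ => hq _ x) (hq1 _) (fun x _ w => hN e' x w) _).trans ?_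
      refine mul_le_mul_of_nonneg_left ?_ (sq_nonneg κ)
      have hre : ∀ x, ((R' e' *ᵥ (W (tgt' e') (σ e' x) *ᵥ fun b => u (σ e' x, b))) - c) ⬝ᵥ
            ((R' e' *ᵥ (W (tgt' e') (σ e' x) *ᵥ fun b => u (σ e' x, b))) - c) =
          ((W (tgt' e') (σ e' x) *ᵥ fun b => u (σ e' x, b)) - fun a => (Q *ᵥ u) (tgt' e', a)) ⬝ᵥ
            ((W (tgt' e') (σ e' x) *ᵥ fun b => u (σ e' x, b)) - fun a => (Q *ᵥ u) (tgt' e', a)) := fun x => by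
        rw [hc, ← mulVec_sub, self_of_orthogonal (hR' e')]
      simp_rw [hre, ← hσq e']
      rw [Equiv.sum_comp (σ e') (fun x => q (tgt' e') x *
        (((W (tgt' e') x *ᵥ fun b => u (x, b)) - fun a => (Q *ᵥ u) (tgt' e', a)) ⬝ᵥ
          ((W (tgt' e') x *ᵥ fun b => u (x, b)) - fun a => (Q *ᵥ u) (tgt' e', a))))]
      exact hP (tgt' e')
    · -- (C) the mean defect against the block mean: `κ₂`, `R′` orthogonal
      refine mul_le_mul_of_nonneg_left ?_ hr'
      refine (hM e' c).trans (le_of_eq ?_)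
      rw [hc, self_of_orthogonal (hR' e')]
  -- sum over the coarse bonds
  have hsum : ∑ e', ((R' e' *ᵥ fun a => (Q *ᵥ u) (tgt' e', a)) - fun a => (Q *ᵥ u) (src' e', a)) ⬝ᵥ
          ((R' e' *ᵥ fun a => (Q *ᵥ u) (tgt' e', a)) - fun a => (Q *ᵥ u) (src' e', a)) ≤
        (1 + t) * (ℓ * ∑ e', ∑ x, q (src' e') x * ∑ i ∈ range ℓ, F (γ e' x i)) +
          (1 + t⁻¹) * ((1 + r) * (κ ^ 2 * ∑ e', Φ u (tgt' e')) + (1 + r⁻¹) * (κ₂ ^ 2 * ∑ e', G (tgt' e'))) := by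
    refine (Finset.sum_le_sum fun e' _ => hper e').trans (le_of_eq ?_)
    simp only [Finset.sum_add_distrib, ← Finset.mul_sum]
  -- the counting sums
  have hmu := sum_chain_le_of_multiplicity q src' γ ℓ hmult F hF0
  have hgr := sum_tgt_blockMean_le (tgt' := tgt') hdeg (Q *ᵥ u)
  have hQQ : 0 ≤ (Q *ᵥ u) ⬝ᵥ (Q *ᵥ u) := dotProduct_self_nonneg' _
  have hSF : 0 ≤ ∑ e, F e := Finset.sum_nonneg fun e _ => hF0 e
  have hHfu := hHf u
  -- assemble
  refine (hHc _).trans ?_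
  refine (mul_le_mul_of_nonneg_left hsum hwc).trans ?_
  have h1 : wc * ((1 + t) * (ℓ * ∑ e', ∑ x, q (src' e') x * ∑ i ∈ range ℓ, F (γ e' x i))) ≤ (1 + t) * (u ⬝ᵥ (Hf *ᵥ u)) := by
    have a1 : wc * ((1 + t) * (ℓ * ∑ e', ∑ x, q (src' e') x * ∑ i ∈ range ℓ, F (γ e' x i))) ≤ wc * ((1 + t) * (ℓ * (m * ∑ e, F e))) :=
      mul_le_mul_of_nonneg_left (mul_le_mul_of_nonneg_left (mul_le_mul_of_nonneg_left hmu (Nat.cast_nonneg _)) (by linarith)) hwc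
    have a2 : wc * ((1 + t) * (ℓ * (m * ∑ e, F e))) = (1 + t) * ((wc * ℓ * m) * ∑ e, F e) := by ring
    have a3 : (wc * ℓ * m) * ∑ e, F e ≤ u ⬝ᵥ (Hf *ᵥ u) := (mul_le_mul_of_nonneg_right hw hSF).trans hHfu
    rw [a2] at a1
    exact a1.trans (mul_le_mul_of_nonneg_left a3 (by linarith))
  have h2 : wc * ((1 + t⁻¹) * ((1 + r) * (κ ^ 2 * ∑ e', Φ u (tgt' e')))) ≤ (1 + t⁻¹) * (1 + r) * ϖ * κ ^ 2 * (u ⬝ᵥ (Hf *ᵥ u)) := by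
    have : wc * ((1 + t⁻¹) * ((1 + r) * (κ ^ 2 * ∑ e', Φ u (tgt' e')))) = (1 + t⁻¹) * (1 + r) * κ ^ 2 * (wc * ∑ e', Φ u (tgt' e')) := by ring
    rw [this]
    have := mul_le_mul_of_nonneg_left hΦ (show (0 : ℝ) ≤ (1 + t⁻¹) * (1 + r) * κ ^ 2 by positivity)
    linarith [this]
  have h3 : wc * ((1 + t⁻¹) * ((1 + r⁻¹) * (κ₂ ^ 2 * ∑ e', G (tgt' e')))) ≤ (1 + t⁻¹) * (1 + r⁻¹) * κ₂ ^ 2 * wc * d' * ((Q *ᵥ u) ⬝ᵥ (Q *ᵥ u)) := by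
    have : wc * ((1 + t⁻¹) * ((1 + r⁻¹) * (κ₂ ^ 2 * ∑ e', G (tgt' e')))) = (1 + t⁻¹) * (1 + r⁻¹) * κ₂ ^ 2 * wc * ∑ e', G (tgt' e') := by ring
    rw [this]
    have := mul_le_mul_of_nonneg_left hgr (show (0 : ℝ) ≤ (1 + t⁻¹) * (1 + r⁻¹) * κ₂ ^ 2 * wc by positivity)
    linarith [this]
  have split : wc * ((1 + t) * (ℓ * ∑ e', ∑ x, q (src' e') x * ∑ i ∈ range ℓ, F (γ e' x i)) +
        (1 + t⁻¹) * ((1 + r) * (κ ^ 2 * ∑ e', Φ u (tgt' e')) + (1 + r⁻¹) * (κ₂ ^ 2 * ∑ e', G (tgt' e')))) =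
      wc * ((1 + t) * (ℓ * ∑ e', ∑ x, q (src' e') x * ∑ i ∈ range ℓ, F (γ e' x i))) +
        (wc * ((1 + t⁻¹) * ((1 + r) * (κ ^ 2 * ∑ e', Φ u (tgt' e')))) + wc * ((1 + t⁻¹) * ((1 + r⁻¹) * (κ₂ ^ 2 * ∑ e', G (tgt' e'))))) := by
    ring
  rw [split]
  linarith [h1, h2, h3]

/-- **`posSemidef_covJensen_meanZero` — (STAB-ε,δ) AS THE LOEWNER INEQUALITY PART 20 CONSUMES** (`G = QᵀQ`, a mass on the COARSE field): under the
hypotheses of `covJensen_meanZero` for every `u`, with `H_f`, `H_c` symmetric, for all `t, r > 0`: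
`((1 + t + (1+t⁻¹)(1+r)ϖκ²)•H_f + ((1+t⁻¹)(1+r⁻¹)κ₂²w_c d′)•(QᵀQ) − QᵀH_cQ).PosSemidef`. [our proof] -/
theorem posSemidef_covJensen_meanZero [DecidableEq ν]
    (hq : ∀ y x, 0 ≤ q y x) (hq1 : ∀ y, ∑ x, q y x ≤ 1) (hW : ∀ y x, (W y x)ᵀ * W y x = 1) (hR : ∀ e, (R e)ᵀ * R e = 1)
    (hR' : ∀ e', (R' e')ᵀ * R' e' = 1)
    (hQ : ∀ (u : ν × o → ℝ) (y : μ), (fun a => (Q *ᵥ u) (y, a)) = ∑ x, q y x • (W y x *ᵥ fun b => u (x, b)))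
    (hwc : 0 ≤ wc) (hHfs : Hfᵀ = Hf) (hHcs : Hcᵀ = Hc)
    (hHc : ∀ v : μ × o → ℝ, v ⬝ᵥ (Hc *ᵥ v) ≤
      wc * ∑ e', ((R' e' *ᵥ fun a => v (tgt' e', a)) - fun a => v (src' e', a)) ⬝ᵥ
        ((R' e' *ᵥ fun a => v (tgt' e', a)) - fun a => v (src' e', a)))
    (hHf : ∀ u : ν × o → ℝ, wf * ∑ e, ((R e *ᵥ fun b => u (tgt e, b)) - fun b => u (src e, b)) ⬝ᵥ
        ((R e *ᵥ fun b => u (tgt e, b)) - fun b => u (src e, b)) ≤ u ⬝ᵥ (Hf *ᵥ u))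
    (hσq : ∀ e' x, q (tgt' e') (σ e' x) = q (src' e') x)
    (hx0 : ∀ e' x, xs e' x 0 = x) (hxℓ : ∀ e' x, xs e' x ℓ = σ e' x)
    (hsrc : ∀ e' x i, i < ℓ → src (γ e' x i) = xs e' x i) (htgt : ∀ e' x i, i < ℓ → tgt (γ e' x i) = xs e' x (i + 1))
    (hT0 : ∀ e' x, T e' x 0 = 1) (hT : ∀ e' x i, i < ℓ → T e' x (i + 1) = T e' x i * R (γ e' x i))
    (hmult : ∀ e, ∑ e', ∑ x, ∑ i ∈ range ℓ, (if γ e' x i = e then q (src' e') x else 0) ≤ m)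
    (hw : wc * ℓ * m ≤ wf)
    (hNdef : ∀ e' x, N e' x = 1 - W (src' e') x * T e' x ℓ * (W (tgt' e') (σ e' x))ᵀ * (R' e')ᵀ)
    (hN : ∀ e' x (w : o → ℝ), (N e' x *ᵥ w) ⬝ᵥ (N e' x *ᵥ w) ≤ κ ^ 2 * (w ⬝ᵥ w))
    (hM : ∀ e' (w : o → ℝ), ((∑ x, q (src' e') x • N e' x) *ᵥ w) ⬝ᵥ ((∑ x, q (src' e') x • N e' x) *ᵥ w) ≤ κ₂ ^ 2 * (w ⬝ᵥ w))
    (hP : ∀ (u : ν × o → ℝ) y, ∑ x, q y x * (((W y x *ᵥ fun b => u (x, b)) - fun a => (Q *ᵥ u) (y, a)) ⬝ᵥ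
        ((W y x *ᵥ fun b => u (x, b)) - fun a => (Q *ᵥ u) (y, a))) ≤ Φ u y)
    (hΦ : ∀ u : ν × o → ℝ, wc * ∑ e', Φ u (tgt' e') ≤ ϖ * (u ⬝ᵥ (Hf *ᵥ u)))
    (hdeg : ∀ y, ((Finset.univ.filter fun e' => tgt' e' = y).card : ℝ) ≤ d')
    {t r : ℝ} (ht : 0 < t) (hr : 0 < r) :
    ((1 + t + (1 + t⁻¹) * (1 + r) * ϖ * κ ^ 2) • Hf + ((1 + t⁻¹) * (1 + r⁻¹) * κ₂ ^ 2 * wc * d') • (Qᵀ * Q) - Qᵀ * Hc * Q).PosSemidef := by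
  refine PosSemidef.of_dotProduct_mulVec_nonneg ?_ fun u => ?_
  · rw [Matrix.IsHermitian, Matrix.conjTranspose_eq_transpose_of_trivial, transpose_sub, transpose_add, transpose_smul, transpose_smul,
      transpose_mul, transpose_transpose, hHfs, transpose_mul, transpose_mul, transpose_transpose, hHcs, Matrix.mul_assoc]
  · simp only [star_trivial, sub_mulVec, add_mulVec, dotProduct_sub, dotProduct_add, smul_mulVec, dotProduct_smul, smul_eq_mul, sub_nonneg]
    have e1 : u ⬝ᵥ ((Qᵀ * Hc * Q) *ᵥ u) = (Q *ᵥ u) ⬝ᵥ (Hc *ᵥ (Q *ᵥ u)) := by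
      rw [mulVec_dotProduct_eq, mulVec_mulVec, mulVec_mulVec, Matrix.mul_assoc]
    have e2 : u ⬝ᵥ ((Qᵀ * Q) *ᵥ u) = (Q *ᵥ u) ⬝ᵥ (Q *ᵥ u) := by
      rw [mulVec_dotProduct_eq, mulVec_mulVec]
    rw [e1, e2]
    exact covJensen_meanZero hq hq1 hW hR hR' hQ hwc hHc hHf hσq hx0 hxℓ hsrc htgt hT0 hT hmult hw hNdef hN hM u (hP u) (hΦ u) hdeg ht hr

end End

end Summit.QuantumFields.BalabanUV.Beta.GAN24.DerivativeRateTransferJensenMeanZero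

end
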